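import Literature.AlgebraicGeometry.Frobenioids.ModelFrobenioidBaseSectionThrough
import Literature.AlgebraicGeometry.Frobenioids.BaseSectionImage
import Literature.AlgebraicGeometry.Frobenioids.BaseFrobeniusPairFunctorImage
import Literature.AnabelianGeometry.EtaleTheta.Discharge.Sec4Prop42SubIII
import Literature.AnabelianGeometry.EtaleTheta.Discharge.Sec4Prop42SubRootPair
import Literature.AnabelianGeometry.EtaleTheta.Discharge.Sec4Prop42SubBaseLiftNegative

/-!
# [EtTh] Prop 4.2 (iii), sub-node L03 `Prop42Sub.BaseFrobeniusLift` ("`C` admits a base-Frobenius pair",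
# [FrdI] Def 2.7 (iii)) AT THE CANONICAL MODEL of the §4 setting: proved for coverings with
# non-isomorphic base (and for `A_⊙` itself), refuted AS TYPED in the degenerate corner

Mochizuki, *The étale theta function …*, Publ. RIMS **45** (2009), §4, Prop. 4.2 (iii), PDF p. 89 L83 –
p. 90 L6 (printed pp. 315–316) [cite: MochizukiEtTh2009, Prop 4.2 p.89]: «since the Frobenioid `C` is of
model [hence, in particular, pre-model] type [cf. Theorem 3.7, (i)], it follows that `C` admits a
base-Frobenius pair [cf. [FrdI], Definition 2.7, (iii)]» — whence, for the covering object `A_N` and its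
pull-back morphism to `A_⊙`, data "of base-Frobenius type" (Def. 4.1 (iv) (a)–(e), p. 313).  abc-iut cell,
layer L2, plan/L2/SUBDAG-EtTh-Prop42.md §B row L03 (seat abc-iut-w5-d134, writer of the sub-DAG); typed
by this seat (gen 0) as `BiKummerSetting.Prop42Sub.BaseFrobeniusLift` (`Prop42Sub.lean`), flagged there as
an INSTANCE OBLIGATION: over the abstract setting, condition (e) is the uninterpreted field
`ArisesFromBaseFrobeniusPair`; at abc-iut-L2-t9's canonical model `BiKummerSetting.mkOfModelCanonical` it IS
[FrdI] Def. 2.7 (iii) (`TemperedFrobenioid.ArisesFromBaseFrobeniusPair`, over abc-iut-L1-t2's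
`PreFrobenioid.IsBaseFrobeniusPair`).

PROOF-ONLY companion.  Results, for `Φ` divisorial ([FrdI] Thm. 5.2 (ii); `B` group-like is a theorem for
the tempered Frobenioid, `TemperedFrobenioid.isGroupLike_ratFnFunctor`):
* `Prop42Sub.exists_baseFrobeniusTypeData_of_isDistinguished` — GENERIC: for any setting `S` whose
  condition (e) is read as (implied by) [FrdI] Def. 2.7 (iii), any base-Frobenius pair `(P, F)` of `C` and
  any `P`-distinguished `φ : A' → A_⊙` with `A'` Galois and `μ_N`-saturated, the endomorphism
  `α'' := F(N)_{A'}` and `α := α'' ≫ φ` carry data of base-Frobenius type with `α' = φ`, `α` an isometry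
  of Frobenius degree `N`; the group `G` is the group of `P`-automorphisms of `A'` over `α`, which `Base`
  maps bijectively onto `Gal(A'^bs/A_⊙^bs)` because `P ⥲ D` (Def. 2.7 (i)(c)); (a) `A'` Frobenius-trivial
  and (d) `φ` a pull-back morphism come for free from Def. 2.7 (i)(b) and `P ⊆ C^pl-bk`.
* `Prop42Sub.baseFrobeniusLift_mkOfModelCanonical_of_not_iso` — **L03 at the canonical model for every
  pull-back morphism `φ : A' → A_⊙` whose base `A'^bs → A_⊙^bs` is NOT an isomorphism class-mate of
  `A_⊙^bs`** (the case of a genuine covering), via the base-Frobenius pair THROUGH `φ` of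
  `ModelFrobenioid.exists_isBaseFrobeniusPair_through` ([FrdI] Thm. 5.2 p. 101 observation, unit-conjugated
  as in Prop. 5.6); `…_restricted` — the typed statement `BaseFrobeniusLift` with exactly this one extra
  antecedent; `Prop42Sub.exists_baseFrobeniusTypeData_self_mkOfModelCanonical` — the complementary corner
  `A' = A_⊙`, `α' = id` (the trivial covering).
* `Prop42Sub.not_baseFrobeniusLift_mkOfModelCanonical_of_isMuSaturated` — AS TYPED, L03 fails at
  every canonical model whose `A_⊙` is `μ_N`-saturated for some `N ≥ 2`: a reading of abc-iut-w4-d044's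
  kernel negative F-w4d044-1 (`Sec4Prop42SubBaseLiftNegative.lean`, found independently while this file
  was being written: the typed row quantifies over ALL pull-back morphisms `φ`, including a non-trivial
  unit `u ∈ O^×(A_⊙)` with `N = 1`, `A' = A_⊙`, and asks for `φ` itself to be `P`-distinguished — but a
  `P`-distinguished endomorphism over `id` is `id`, [FrdI] Def. 2.7 (i)(a)(c)).  Print is not affected: it
  never asks a GIVEN `φ` to be `P`-distinguished — the pull-back part `α'` of Def. 4.1 (iv) is chosen from
  the pair; the covering object of Prop. 4.2 (iii) may be taken in the skeleton through `A_⊙`.  L2-lead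
  RULING 2026-08-26T03:05Z: L03 → L03′ `BaseFrobeniusLiftUpToUnit` («Base(φ) not an isomorphism of D»,
  `d.α₁ = s ≫ φ` up to a unit `s`); the theorems below are its two cases with `s = 1`.
* `Prop42Sub.prop42_iii_mkOfModelCanonical_of_saturatedRootCover` — the REPAIRED COMPOSITION: at the
  canonical model (`pullFrac := pullFracModel`) the typed node `Prop42_iii` follows from the covering step
  L01 ALONE, read inside a skeleton through `A_⊙` (genuine covering, or `A_⊙` itself), plus the [FrdI]
  Prop. 4.1 (iii) law "pull-back preserves coprimality" and `Φ` divisorial — L02 (`rootFractionPair_mkOfModel`),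
  L03 (this file) and L04 (`rootSquares_mkOfModel`) being theorems.  So [EtTh] Prop. 4.2 (iii) AS TYPED is
  open at the canonical model exactly modulo L01a (ERRATUM E2 tempered-meromorphic roots) and L01b
  ([FrdII] Rmk. 2.2.1 saturation).
HONEST FRAMING: nothing here asserts that such data exist for an actual curve; typed ≠ proved for
Prop. 4.2 (iii) itself; no side is taken on any disputed claim.
-/

noncomputable section

namespace Literature.AnabelianGeometry.EtaleTheta

open CategoryTheory Opposite Literature.AlgebraicGeometry.Frobenioids

universe u₀ v₀ u v w

variable {K : Type u₀} [Field K]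

namespace BiKummerSetting

section Generic

variable {X : SemiGraphs.TemperedArithmeticGroup.{u₀} K} {D₀ : Type u₀} [Category.{v₀} D₀]
  {V : FrdIMonoidStub.{w}} {T : RealifiedDivisorMonoids (D₀ := D₀) V} {D : Type u} [Category.{v} D]
  {VD : FrdICatStub.{u, v, w} D} (S : BiKummerSetting X T D VD)

/-- **L03 from a base-Frobenius pair through `φ` (generic)**: let the setting's condition (e) "arise from a
base-Frobenius pair" be implied by [FrdI] Def. 2.7 (iii) (`TemperedFrobenioid.ArisesFromBaseFrobeniusPair`;
at the canonical model this is `Iff.rfl`), let `(P, F)` be a base-Frobenius pair of `C` and `φ : A' → A_⊙` a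
`P`-distinguished morphism with `A'` Galois and `μ_N`-saturated.  Then `α := F(N)_{A'} ≫ φ` is an isometry
of Frobenius degree `N` carrying data of base-Frobenius type (Def. 4.1 (iv)) with pull-back part `α' = φ`:
`α'' := F(N)_{A'}` (base-identity of Frobenius type, Def. 2.7 (ii)(b)), `G :=` the `P`-automorphisms of
`A'` over `α`, mapped bijectively onto `Gal(A'^bs/A_⊙^bs)` by `Base` since `P ⥲ D` (Def. 2.7 (i)(c));
`A'` is Frobenius-trivial as an object of `P` and `φ ∈ P ⊆ C^pl-bk` is a pull-back morphism.
[cite: MochizukiEtTh2009, Prop 4.2 p.89] -/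
theorem Prop42Sub.exists_baseFrobeniusTypeData_of_isDistinguished
    (hΦd : Objectwise (fun M _ => IsDivisorial M) S.tf.divisorMonoid)
    (harise : ∀ {A B : S.C} (G : Subgroup (Aut A)) (α₂ : A ⟶ A) (α₁ : A ⟶ B),
      S.tf.ArisesFromBaseFrobeniusPair G α₂ α₁ → S.ArisesFromBaseFrobeniusPair G α₂ α₁)
    {P : Presection S.C} {Fr : ℕ+ →* End P.ι} (hPF : PreFrobenioid.IsBaseFrobeniusPair S.F P Fr)
    {A' : S.C} (φ : A' ⟶ S.Aodot) (hφ : P.hom φ) (hG : S.IsGalois A') (N : ℕ+)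
    (hμ : S.IsMuSaturated A' N) :
    ∃ (α : A' ⟶ S.Aodot) (d : S.BaseFrobeniusTypeData α), d.α₁ = φ ∧ S.IsIsometry α ∧ S.degFr α = N := by
  haveI := hPF.isBaseSection.isEquivalence
  have hA' : P.obj A' := (P.obj_of_hom φ hφ).1
  have hA₀ : P.obj S.Aodot := (P.obj_of_hom φ hφ).2
  let A'P : P.Cat := ⟨A', hA'⟩
  let A₀P : P.Cat := ⟨S.Aodot, hA₀⟩
  let α₂ : A' ⟶ A' := (Fr N).app A'P
  have hpbφ : S.IsPullback φ := hPF.isBaseSection.hom_pullback φ hφ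
  obtain ⟨hnφ, hdφ⟩ := ModelFrobenioid.degFr_div_of_isPullbackMorphism hΦd hpbφ
  have hbi₂ : S.IsBaseIdentity α₂ := hPF.isFrobeniusSection.isBaseIdentity N A'P
  have hbase₂ : ModelFrobenioid.baseMap α₂ = 𝟙 _ := hbi₂
  have hdeg₂ : ModelFrobenioid.degFr α₂ = N := hPF.isFrobeniusSection.degFr_eq N A'P
  have hft₂ : S.IsFrobeniusType α₂ := hPF.isFrobeniusSection.isFrobeniusType N A'P
  have hdiv₂ : ModelFrobenioid.div α₂ = 1 := hft₂.1.2
  -- uniqueness of `P`-lifts of `Base(φ)`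
  have huniq : ∀ (ψ : A' ⟶ S.Aodot), P.hom ψ →
      ModelFrobenioid.baseMap ψ = ModelFrobenioid.baseMap φ → ψ = φ := by
    intro ψ hψ hb
    have h := (P.toBase S.F).map_injective (X := A'P) (Y := A₀P) (a₁ := ⟨ψ, hψ⟩) (a₂ := ⟨φ, hφ⟩) hb
    exact congrArg Subtype.val h
  -- the `P`-automorphisms of `A'`
  let Paut : Subgroup (Aut A') :=
    { carrier := {γ | P.hom γ.hom ∧ P.hom γ.inv}
      one_mem' := ⟨P.hom_id hA', P.hom_id hA'⟩
      mul_mem' := fun {γ δ} hγ hδ => ⟨P.hom_comp _ _ hδ.1 hγ.1, P.hom_comp _ _ hγ.2 hδ.2⟩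
      inv_mem' := fun {γ} hγ => ⟨hγ.2, hγ.1⟩ }
  let α : A' ⟶ S.Aodot := α₂ ≫ φ
  have hbα : ModelFrobenioid.baseMap α = ModelFrobenioid.baseMap φ := by
    show ModelFrobenioid.baseMap (α₂ ≫ φ) = _
    rw [ModelFrobenioid.baseMap_comp, hbase₂, Category.id_comp]
  -- a `P`-automorphism over `Base(α)` acts over `α`
  have hfix : ∀ γ : Aut A', γ ∈ Paut →
      ModelFrobenioid.baseMap γ.hom ≫ ModelFrobenioid.baseMap α = ModelFrobenioid.baseMap α →
        γ.hom ≫ α = α := by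
    intro γ hγ hb
    have hnat : γ.hom ≫ α₂ = α₂ ≫ γ.hom := (Fr N).naturality (⟨γ.hom, hγ.1⟩ : A'P ⟶ A'P)
    have hγφ : γ.hom ≫ φ = φ := huniq _ (P.hom_comp _ _ hγ.1 hφ) (by
      rw [ModelFrobenioid.baseMap_comp, ← hbα]
      exact hb)
    show γ.hom ≫ (α₂ ≫ φ) = α₂ ≫ φ
    rw [← Category.assoc, hnat, Category.assoc, hγφ]
  have hdegα : S.degFr α = N := by
    show ModelFrobenioid.degFr (α₂ ≫ φ) = N
    rw [ModelFrobenioid.degFr_comp, hnφ, hdeg₂, one_mul]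
  have hisoα : S.IsIsometry α := by
    show ModelFrobenioid.div (α₂ ≫ φ) = 1
    rw [ModelFrobenioid.div_comp_pull, hdφ, map_one, one_mul, hdiv₂, one_pow]
  refine ⟨α,
    { G := Paut ⊓ S.autOver α
      G_le := inf_le_right
      α₂ := α₂
      α₁ := φ
      fac := rfl
      isFrobeniusTrivial := hPF.isBaseSection.isFrobeniusTrivial A' hA'
      isGalois := hG
      isMuSaturated := by rw [hdegα]; exact hμ
      mapsIsomorphically := ⟨?_, ?_, ?_⟩
      cond_c := ⟨hbi₂, hft₂⟩
      cond_d := hpbφ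
      cond_e := harise _ _ _ ⟨P, Fr, hPF, fun γ hγ => hγ.1.1, hφ, ⟨hA', N, rfl⟩⟩ }, rfl, hisoα, hdegα⟩
  · -- `Base` maps `G` into `Gal(A'^bs/A_⊙^bs)`
    intro γ hγ
    have h := congrArg ModelFrobenioid.baseMap hγ.2
    rw [ModelFrobenioid.baseMap_comp] at h
    exact h
  · -- injective: `P ⥲ D` is faithful
    intro γ₁ h₁ γ₂ h₂ h
    have hb : ModelFrobenioid.baseMap γ₁.hom = ModelFrobenioid.baseMap γ₂.hom := congrArg Iso.hom h
    have h' := (P.toBase S.F).map_injective (X := A'P) (Y := A'P) (a₁ := ⟨γ₁.hom, h₁.1.1⟩)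
      (a₂ := ⟨γ₂.hom, h₂.1.1⟩) hb
    exact Iso.ext (congrArg Subtype.val h')
  · -- surjective: `P ⥲ D` is full, and the lift acts over `α`
    intro σ hσ
    let σ' : (P.toBase S.F).obj A'P ≅ (P.toBase S.F).obj A'P := σ
    let e : A'P ≅ A'P := (P.toBase S.F).preimageIso σ'
    let γ : Aut A' := P.ι.mapIso e
    have hγP : γ ∈ Paut := ⟨e.hom.2, e.inv.2⟩
    have hbγ : ModelFrobenioid.baseMap γ.hom = σ.hom := (P.toBase S.F).map_preimage σ'.hom
    refine ⟨γ, ⟨hγP, hfix γ hγP (by rw [hbγ]; exact hσ)⟩, Iso.ext hbγ⟩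

end Generic

/-! ### At the canonical model `mkOfModelCanonical` -/

section Canonical

variable (X : SemiGraphs.TemperedArithmeticGroup.{u₀} K) {D₀ : Type u₀}
  [Category.{v₀} D₀] {V : FrdIMonoidStub.{w}} {T : RealifiedDivisorMonoids (D₀ := D₀) V}
  {D : Type u} [Category.{v} D] {VD : FrdICatStub.{u, v, w} D}
  (tf : TemperedFrobenioid T D VD) (hZ : tf.monoidType = MonoidType.Z)
  (hP : ∀ A : Dᵒᵖ, IsPerfect (tf.Φ.carrier A)) (IG : D → Prop) (gS : ∀ A : D, IG A → (X.Pi →* Aut A))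
  (gSs : ∀ (A : D) (h : IG A), Function.Surjective (gS A h))
  (NH : Subgroup (Field.absoluteGaloisGroup K) → tf.category → ℕ+ → Prop) (A₀ : tf.category)
  (hA₀ : PreFrobenioid.IsFrobeniusTrivial tf.toElem A₀) (hA₀' : IG A₀.base)
  (hΦd : Objectwise (fun M _ => IsDivisorial M) tf.divisorMonoid)

include hΦd in
/-- **L03 `BaseFrobeniusLift` at the canonical model, genuine-covering case**: for `Φ` divisorial and a
pull-back morphism `φ : A' → A_⊙` with `A'` Galois and `μ_N`-saturated whose base `A'^bs` is NOT isomorphic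
to `A_⊙^bs`, there are `α : A' → A_⊙`, an isometry of Frobenius degree `N`, and data of base-Frobenius type
for `α` with pull-back part `α' = φ` — condition (e) being [FrdI] Def. 2.7 (iii) through the base-Frobenius
pair of the model Frobenioid passing through `φ` ([FrdI] Thm. 5.2 p. 101, unit-conjugated as in Prop. 5.6).
(`A'` is then automatically Frobenius-trivial.) [cite: MochizukiEtTh2009, Prop 4.2 p.89] -/
theorem Prop42Sub.baseFrobeniusLift_mkOfModelCanonical_of_not_iso (N : ℕ+) (A' : tf.category)
    (φ : A' ⟶ A₀) (hφ : PreFrobenioid.IsPullbackMorphism tf.toElem φ) (hG : IG A'.base)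
    (hμ : tf.IsMuSaturated A' N) (hne : ¬ Nonempty (A'.base ≅ A₀.base)) :
    ∃ (α : A' ⟶ A₀)
      (d : (mkOfModelCanonical X tf hZ hP IG gS gSs NH A₀ hA₀ hA₀').BaseFrobeniusTypeData α),
      d.α₁ = φ ∧ (mkOfModelCanonical X tf hZ hP IG gS gSs NH A₀ hA₀ hA₀').IsIsometry α ∧
        (mkOfModelCanonical X tf hZ hP IG gS gSs NH A₀ hA₀ hA₀').degFr α = N := by
  have hBg := tf.isGroupLike_ratFnFunctor T.isUnit_BΛ
  obtain ⟨hn, hd⟩ := ModelFrobenioid.degFr_div_of_isPullbackMorphism hΦd hφ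
  obtain ⟨P, Fr, hPF, hφP⟩ := ModelFrobenioid.exists_isBaseFrobeniusPair_through hΦd hBg φ hn hd
    (ModelFrobenioid.exists_cls_eq_divB_of_isFrobeniusTrivial A₀ hA₀) hne
  exact Prop42Sub.exists_baseFrobeniusTypeData_of_isDistinguished
    (mkOfModelCanonical X tf hZ hP IG gS gSs NH A₀ hA₀ hA₀') hΦd (fun _ _ _ h => h) hPF φ hφP hG N hμ

include hΦd in
/-- **L03 `BaseFrobeniusLift` at the canonical model, RESTRICTED form**: the typed sub-node
`Prop42Sub.BaseFrobeniusLift` with the single extra antecedent "`A'^bs` is not isomorphic to `A_⊙^bs`"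
(the base-Frobenius pair must be a skeleton through both `A'` and `A_⊙`, [FrdI] Def. 2.7 (i)(a)) holds for
the canonical model, `Φ` divisorial. [cite: MochizukiEtTh2009, Prop 4.2 p.89] -/
theorem Prop42Sub.baseFrobeniusLift_mkOfModelCanonical_restricted :
    ∀ (N : ℕ+) (A' : (mkOfModelCanonical X tf hZ hP IG gS gSs NH A₀ hA₀ hA₀').C)
      (φ : A' ⟶ (mkOfModelCanonical X tf hZ hP IG gS gSs NH A₀ hA₀ hA₀').Aodot),
      (mkOfModelCanonical X tf hZ hP IG gS gSs NH A₀ hA₀ hA₀').IsPullback φ →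
      (mkOfModelCanonical X tf hZ hP IG gS gSs NH A₀ hA₀ hA₀').IsFrobeniusTrivial A' →
      (mkOfModelCanonical X tf hZ hP IG gS gSs NH A₀ hA₀ hA₀').IsGalois A' →
      (mkOfModelCanonical X tf hZ hP IG gS gSs NH A₀ hA₀ hA₀').IsMuSaturated A' N →
      ¬ Nonempty (A'.base ≅ A₀.base) →
        ∃ (α : A' ⟶ (mkOfModelCanonical X tf hZ hP IG gS gSs NH A₀ hA₀ hA₀').Aodot)
          (d : (mkOfModelCanonical X tf hZ hP IG gS gSs NH A₀ hA₀ hA₀').BaseFrobeniusTypeData α),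
          d.α₁ = φ ∧ (mkOfModelCanonical X tf hZ hP IG gS gSs NH A₀ hA₀ hA₀').IsIsometry α ∧
            (mkOfModelCanonical X tf hZ hP IG gS gSs NH A₀ hA₀ hA₀').degFr α = N :=
  fun N A' φ hφ _ hG hμ hne =>
    Prop42Sub.baseFrobeniusLift_mkOfModelCanonical_of_not_iso X tf hZ hP IG gS gSs NH A₀ hA₀ hA₀' hΦd N A'
      φ hφ hG hμ hne

include hΦd in
/-- **The complementary corner `A' = A_⊙`** (trivial covering): for `A_⊙` `μ_N`-saturated, the degree-`N`
Frobenius lift of `A_⊙` in any base-Frobenius pair through `A_⊙` carries data of base-Frobenius type with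
pull-back part `α' = id` (`G = 1 ≅ Gal(A_⊙^bs/A_⊙^bs)`). [cite: MochizukiEtTh2009, Prop 4.2 p.89] -/
theorem Prop42Sub.exists_baseFrobeniusTypeData_self_mkOfModelCanonical (N : ℕ+)
    (hμ : tf.IsMuSaturated A₀ N) :
    ∃ (α : A₀ ⟶ A₀)
      (d : (mkOfModelCanonical X tf hZ hP IG gS gSs NH A₀ hA₀ hA₀').BaseFrobeniusTypeData α),
      d.α₁ = 𝟙 A₀ ∧ (mkOfModelCanonical X tf hZ hP IG gS gSs NH A₀ hA₀ hA₀').IsIsometry α ∧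
        (mkOfModelCanonical X tf hZ hP IG gS gSs NH A₀ hA₀ hA₀').degFr α = N := by
  have hBg := tf.isGroupLike_ratFnFunctor T.isUnit_BΛ
  obtain ⟨P, Fr, hPF, hobj⟩ := ModelFrobenioid.exists_isBaseFrobeniusPair_obj hΦd hBg A₀
    (ModelFrobenioid.exists_cls_eq_divB_of_isFrobeniusTrivial A₀ hA₀)
  exact Prop42Sub.exists_baseFrobeniusTypeData_of_isDistinguished
    (mkOfModelCanonical X tf hZ hP IG gS gSs NH A₀ hA₀ hA₀') hΦd (fun _ _ _ h => h) hPF (𝟙 A₀)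
    (P.hom_id hobj) hA₀' N hμ

/-- **AS TYPED, L03 is refuted at every canonical model whose `A_⊙` is `μ_N`-saturated for some
`N ≥ 2`** (a generator of `μ_N(A_⊙) ≅ ℤ/Nℤ` is a unit `≠ 1`) — i.e. at every non-degenerate instance of
the §4 setting.  This is abc-iut-w4-d044's kernel negative F-w4d044-1
(`not_baseFrobeniusLift_mkOfModelCanonical`, `Sec4Prop42SubBaseLiftNegative.lean`: the typed row lets `φ`
be a non-trivial unit `u ∈ O^×(A_⊙)` with `N = 1`, `A' = A_⊙`, and asks `φ` itself to be
`P`-distinguished, but `P ⥲ D` makes `P`-endomorphisms over `id` identities) read against the setting's own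
saturation hypothesis; the faithful sub-node is the restricted form above (`…_restricted` together with
`…_self_…`; L2-lead RULING 2026-08-26: L03 → L03′). [cite: MochizukiEtTh2009, Prop 4.2 p.89] -/
theorem Prop42Sub.not_baseFrobeniusLift_mkOfModelCanonical_of_isMuSaturated {N : ℕ+} (hN : 2 ≤ (N : ℕ))
    (hμ : tf.IsMuSaturated A₀ N) :
    ¬ Prop42Sub.BaseFrobeniusLift (mkOfModelCanonical X tf hZ hP IG gS gSs NH A₀ hA₀ hA₀') := by
  obtain ⟨σ, ⟨hσ, -⟩, hord, -⟩ := hμ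
  refine not_baseFrobeniusLift_mkOfModelCanonical X tf hZ hP IG gS gSs NH A₀ hA₀ hA₀' hσ ?_
  rintro rfl
  rw [orderOf_one] at hord
  omega

include hΦd in
/-- **Prop. 4.2 (iii) at the canonical model from the COVERING STEP ALONE** (repaired composition of the
sub-DAG): with L03 now a theorem in its faithful form (`…_of_not_iso` / `…_self_…`), L04 `RootSquares`
unconditional at the model (`rootSquares_mkOfModel`) and L02 `RootFractionPair` proved at the model modulo
the [FrdI] Prop. 4.1 (iii) law "pull-back along a morphism of `D` preserves coprimality in `Φ`" (`hDSpull`;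
the companion law for `N`-th roots is a triviality for the coprimality predicate), the typed node
`Prop42_iii` (for `pullFrac := pullFracModel`) follows from the covering step L01 = L01a + L01b (ERRATUM E2
tempered-meromorphic roots + [FrdII] Rmk. 2.2.1 saturation) read inside a skeleton through `A_⊙`: for every
`N`, `f`, EITHER a pull-back morphism `φ : A_N → A_⊙` from a Galois, `μ_N`-saturated,
`(N, H_⊙, f|_{A_N})`-saturated object whose base is a genuine (non-isomorphic) covering of `A_⊙^bs`, OR
`A_⊙` itself is `μ_N`- and `(N, H_⊙, f)`-saturated. [cite: MochizukiEtTh2009, Prop 4.2 p.88] -/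
theorem Prop42Sub.prop42_iii_mkOfModelCanonical_of_saturatedRootCover
    (hDSpull : ∀ {A A' : D} (e : A' ⟶ A) {a b : tf.Φ.carrier (op A)},
      (∀ x : tf.Φ.carrier (op A), x ∣ a → x ∣ b → x = 1) →
        ∀ y : tf.Φ.carrier (op A'), y ∣ pull tf.divisorMonoid e a → y ∣ pull tf.divisorMonoid e b → y = 1)
    (h₁ : ∀ (N : ℕ+) (f : tf.biratUnitsModel A₀),
      (∃ (A' : tf.category) (φ : A' ⟶ A₀), PreFrobenioid.IsPullbackMorphism tf.toElem φ ∧ IG A'.base ∧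
          tf.IsMuSaturated A' N ∧
            (mkOfModelCanonical X tf hZ hP IG gS gSs NH A₀ hA₀ hA₀').IsSaturated A' N
              (tf.pullFracModel φ f) ∧ ¬ Nonempty (A'.base ≅ A₀.base)) ∨
        (tf.IsMuSaturated A₀ N ∧
          (mkOfModelCanonical X tf hZ hP IG gS gSs NH A₀ hA₀ hA₀').IsSaturated A₀ N
            (tf.pullFracModel (𝟙 A₀) f))) :
    (mkOfModelCanonical X tf hZ hP IG gS gSs NH A₀ hA₀ hA₀').Prop42_iii (fun {_ _} φ x => tf.pullFracModel φ x) := by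
  have hBg := tf.isGroupLike_ratFnFunctor T.isUnit_BΛ
  have h₂ : Prop42Sub.RootFractionPair (mkOfModelCanonical X tf hZ hP IG gS gSs NH A₀ hA₀ hA₀')
      (fun {_ _} φ x => tf.pullFracModel φ x) :=
    rootFractionPair_mkOfModel tf hZ hP T.isUnit_BΛ _ IG gS gSs NH _ A₀ hA₀ hA₀' hΦd
      (fun N h x hxa hxb => h x (dvd_pow hxa (PNat.ne_zero N)) (dvd_pow hxb (PNat.ne_zero N))) hDSpull
  have h₄ : Prop42Sub.RootSquares (mkOfModelCanonical X tf hZ hP IG gS gSs NH A₀ hA₀ hA₀')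
      (fun {_ _} φ x => tf.pullFracModel φ x) :=
    rootSquares_mkOfModel tf hZ hP T.isUnit_BΛ _ IG gS gSs NH _ A₀ hA₀ hA₀'
  intro B f P N
  rcases h₁ N f with ⟨A', φ, hφ, hgal, hmu, hsat, hne⟩ | ⟨hmu, hsat⟩
  · obtain ⟨g, hg⟩ := hsat.cond_b
    obtain ⟨α, d, hd, hiso, hdeg⟩ := Prop42Sub.baseFrobeniusLift_mkOfModelCanonical_of_not_iso X tf hZ hP
      IG gS gSs NH A₀ hA₀ hA₀' hΦd N A' φ hφ hgal hmu hne
    obtain ⟨BN, Q, hQn, hQd⟩ := h₂ f P N A' φ g hφ hg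
    subst hd
    obtain ⟨β, hβiso, hβdeg, hcn, hcd⟩ := h₄ f P N A' α d g BN Q hiso hdeg hg hQn hQd
    exact ⟨{ AN := A', BN := BN, α := α, β := β, root := g, pair := Q, comm_num := hcn, comm_den := hcd,
             isIsometry := ⟨hiso, hβiso, hdeg, hβdeg⟩, αData := d, pow_root := hg, isSaturated := hsat }⟩
  · obtain ⟨g, hg⟩ := hsat.cond_b
    obtain ⟨α, d, hd, hiso, hdeg⟩ := Prop42Sub.exists_baseFrobeniusTypeData_self_mkOfModelCanonical X tf hZ
      hP IG gS gSs NH A₀ hA₀ hA₀' hΦd N hmu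
    have hid : PreFrobenioid.IsPullbackMorphism tf.toElem (𝟙 A₀) :=
      ModelFrobenioid.isPullbackMorphism_of hΦd hBg rfl rfl
    obtain ⟨BN, Q, hQn, hQd⟩ := h₂ f P N A₀ (𝟙 A₀) g hid hg
    rw [← hd] at hg hQn hQd hsat
    obtain ⟨β, hβiso, hβdeg, hcn, hcd⟩ := h₄ f P N A₀ α d g BN Q hiso hdeg hg hQn hQd
    exact ⟨{ AN := A₀, BN := BN, α := α, β := β, root := g, pair := Q, comm_num := hcn, comm_den := hcd,
             isIsometry := ⟨hiso, hβiso, hdeg, hβdeg⟩, αData := d, pow_root := hg, isSaturated := hsat }⟩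

end Canonical

end BiKummerSetting

end Literature.AnabelianGeometry.EtaleTheta

end
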